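import Summits.QuantumFields.BalabanUV.Beta.SymRootedMixedJetReflectionLaw
import Summits.QuantumFields.BalabanUV.Beta.RootedMixedJetContact

/-!
# `BalabanUV.Beta.SymRootedMixedJetContact` — THE CONTACT JETS AND THE LONGITUDINAL COMMUTATOR OF THE (0.4)-SYMMETRISED ROOTED MIXED JET IN
# THE PAIR-FAMILY COUNTS `symHessUAt`, `symLinU` (β sub-cell, row D1, TABLES-SYM-LEAN S2c, INTERFACE-LEVEL twin «M3aσ-mixed» of an3's
# `RootedMixedJetContact`; an1 gen 43)

HONEST FRAMING (cell charter, verbatim): «discharging BetaPertH makes Bałaban's UV stability UNCONDITIONAL — a real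
constructive-QFT result; it is NOT the continuum limit and NOT the Clay problem.»  HONEST DEPENDENCY (verbatim): «continuum YM on
T⁴ ⇐ BetaPertH ∧ nine spine estimates (0/9 proved); BetaPertH ⇐ (D1) ∧ (D4) ∧ CAP+tail; G-an2-4 gates asym, D1 and NE2/3/4.»
ABSOLUTE RULE (R-g25-7 ∕ R-D1-g30-1 (A)): the (0.4)-symmetrised averaging is the exp of the MEAN OF LOGS over the pair family
`{loop^{σ,σ′}}` with weight `((d!)²·L^d)⁻¹`; every object below is the comb module's algebra read on an1's `symPhiGAt` (S2b part 1)
instead of `PhiGAt` — STATEMENT FOR STATEMENT under the dictionary `PhiXAt ↦ symPhiXAt`, `XjetAt ↦ symXjetAt`, `MσXAt ↦ symMσXAt`,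
`L^{-d}·linAvgAt ↦ (d!·L^d)⁻¹·symLinU`, `L^{-d}·hessUAt ↦ ((d!)²L^d)⁻¹·symHessUAt`, `L^{-2d}·vhUAt ↦ ((d!)²L^{2d})⁻¹·symVhUAt`
(an3-g63 [AN3-G63-S2C] (C-ii): constants PER BCH ORDER; CONVENTION `(d!)²` un-normalised inside order-2 sym functionals).
FAMILY-INDEPENDENT chart ∕ letter ∕ `Tau`-algebra lemmas of the comb module are imported BY NAME, never re-proved.
DERIVED cell leaf: [folklore] ring algebra; the `sym*` families are [our object]s.  No statement of Bałaban's papers is typed here, no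
`[cite:]` tag, no `Prop` is minted, no binder of the β-function wall (`hW`/`hR`/`D1Tel`/`D1Rep`, (D1), `BetaPertH`) is instantiated or
discharged; nothing about the VALUES of `symMixFFAt`∕`symVh₂SAt` and no (T2-B)∕(T2-M₂) letter is discharged in this file.
NOT D1, NOT BetaPertH, NOT continuum, NOT Clay.  NOT summit progress.
Provenance: β sub-cell, TABLES-SYM-LEAN S2c option (C) (S2C-SCOPE-v1 94facb80ac685517), unit b2b-balaban-beta-an1-g43 (W-supplier AN1,
FREEZE (0): scratch for a courier; an1 files nothing), 2026-08-21; no existing file touched.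

## What this module proves (any root `ρ` in §2–§3; `ρ = ctr d L`, `L` odd in §4–§5; `(d ! : 𝕜) ≠ 0`, `(L : 𝕜) ≠ 0`, `(2 : 𝕜) ≠ 0` where stated)
* §1 the shadow projections `piW`, `piV`, `mapDual Tau.aug` and their values on the mixed left-chart letters are the comb module's, BY NAME.
* §2 THE CONTACT JETS IN PAIR-FAMILY COUNTS: `c10 (symMσGAt (Zf w v) (Zb w v) (upF D) (Zf 0 0) (Zb 0 0) 0) = (2(d!)²L^d)⁻¹ • (symHessUAt ρ w D + d!•symLinU ρ [w, D])`,
  `c01 (…) = (2(d!)²L^d)⁻¹ • (symHessUAt ρ v D + d!•symLinU ρ [v, D])`, `c00 (…) = (d!·L^d)⁻¹ • symLinU ρ D` (an1's dictionary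
  `c11_logT_symPhiGAt_Y`, `symPhiGAt_X1`).
* §3 `c11 (logT symΦ^M(W,V,B)).fst = (2(d!)²L^d)⁻¹ • symHessUAt ρ W V` and `symΦ^M(0,0,B).snd = ι ((d!·L^d)⁻¹ • symLinU ρ B)`.
* §4 the pull-back to the original side on the axis and THE COMMUTATOR OF THE LONGITUDINAL LAW
  `[(2(d!)²L^d)⁻¹ • symHessUAt ρ_c w v, (d!·L^d)⁻¹ • symLinU ρ_c b̃]` (`c11_comm_bref_self`).
* §5 THE TWO AXIS-REFLECTION LAWS OF `symMjetAt` WITH ALL CORRECTIONS IN COUNTS (`symMjetAt_sref_of_ne_counts`, `symMjetAt_bref_self_counts`).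
-/

namespace Summit.QuantumFields.BalabanUV.Beta.SymRootedMixedJetContact

open Finset
open scoped Nat
open Literature.MathematicalPhysics.QuantumFieldTheory.Balaban1983to89
open Literature.MathematicalPhysics.QuantumFieldTheory.Balaban1983to89.Beta
open AffineAveraging (Form1 box)
open AveragingContoursRooted (ctr)
open AveragingHessianKernels (bw)
open AveragingThirdJet (Tau Rho dmk fst_dmk snd_dmk dfst_mul dsnd_mul upF upF_apply logT invT map_logT map_invT invT_one logT_one
  ι_zero mapDual fst_mapDual snd_mapDual X1 X1b Yf Yb logT_dmk_one augR augR_apply)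
open AveragingThirdJet.Tau (τ₁ τ₂ τ12 ι c00 c10 c01 c11 mk ext4 c11_add c11_neg c11_smul aug aug_apply ιHom ιHom_apply c11_mul_ι
  c11_ι_mul)
open AveragingMixedJetTables (Zf Zb Gm Gmb)
open ResolventReflection (sref bref)
open Summit.QuantumFields.BalabanUV.Beta.RootedHolonomyReflection (R1g)
open Summit.QuantumFields.BalabanUV.Beta.RootedHolonomyReflectionHol (reflPair)
open Summit.QuantumFields.BalabanUV.Beta.TruncatedNil4Calculus (nil4_augR logT_invT invT_invT aug_invT_eq_one)
open Summit.QuantumFields.BalabanUV.Beta.RootedMixedChartReflection (GmL GmbL fst_GmL snd_GmL fst_GmbL snd_GmbL BR reflPair_Zf_Zb reflPair_Zb_Zf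
  augR_Gm augR_Gmb)
open Summit.QuantumFields.BalabanUV.Beta.RootedMixedJetReflectionLaw (Zf_zero Zb_zero R1g_zero BR_zero_zero DR D1R D2R D12R fst_logT
  snd_invT_of_fst_eq_one)
open Summit.QuantumFields.BalabanUV.Beta.SymRootedMixedJetReflectionLaw (fst_symPhiMLAt fst_symPhiMAt fst_symPhiMAt_zero_zero
  symMjetAt_sref_of_ne symMjetAt_bref_self c11_symMσGAt_DR)
open Summit.QuantumFields.BalabanUV.Beta.RootedMixedJetContact (piW piW_apply piV piV_apply piW_GmL_Zf piW_GmbL_Zb piV_GmL_Zf piV_GmbL_Zb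
  aug_GmL_Zf aug_GmbL_Zb)
open Summit.QuantumFields.BalabanUV.Beta.SymAveragingHessianCounts (loopPAt symLinU symHessUAt)
open Summit.QuantumFields.BalabanUV.Beta.SymAveragingMixedJetTables (symPhiGAt map_symPhiGAt symPhiGAt_one symPhiMAt symMjetAt)
open Summit.QuantumFields.BalabanUV.Beta.SymRootedJetDictionary (aug_symPhiGAt_eq_one symPhiGAt_X1 inv_smul_sum_box_loopPAt c11_logT_symPhiGAt_Y
  c11_logT_symPhiGAt_Zf)
open Summit.QuantumFields.BalabanUV.Beta.SymRootedMixedChartReflection (symPhiMLAt symPhiMAt_eq_symPhiMLAt symPhiMLAt_reflPair_self_eq_invT)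
open Summit.QuantumFields.BalabanUV.Beta.SymRootedMixedJetLinear (symMσGAt symMσGAt_one_one_zero)

variable {𝕜 : Type*} [Field 𝕜] {d : ℕ} {𝔸 : Type*} [Ring 𝔸] [Algebra 𝕜 𝔸]

/-! ## §1 The shadow projections and the images of the left-chart letters -/

/-! ## §2 The contact jets in counts -/

/-- [folklore] **THE `τ₁σ`-CONTACT JET IN COUNTS**: `c10 (symMσGAt (Zf w v) (Zb w v) (upF D) (Zf 0 0) (Zb 0 0) 0)`
`= (2(d!)²L^d)⁻¹ • (symHessUAt ρ w D + (d ! : ℤ) • symLinU ρ [w, D])` (the `piW`-shadow of the left chart is node 12's shadow chart `Y(w; D)`; 33M3a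
`c11_logT_symPhiGAt_Y`). -/
theorem c10_symMσGAt_contact (ρ : Fin d → ℤ) (w v D : Form1 d 𝔸) {L : ℕ} (hd : ((d ! : ℕ) : 𝕜) ≠ 0) (hL : (L : 𝕜) ≠ 0) (h2 : (2 : 𝕜) ≠ 0) (μ : Fin d)
    (y : Fin d → ℤ) :
    c10 (symMσGAt 𝕜 ρ (Zf 𝕜 w v) (Zb 𝕜 w v) (upF D) (Zf 𝕜 0 0) (Zb 𝕜 0 0) 0 L μ y)
      = ((2 : 𝕜) * ((d ! : 𝕜) ^ 2 * (L : 𝕜) ^ d))⁻¹ • (symHessUAt ρ w D L μ y + (d ! : ℤ) • symLinU ρ (bw w D) L μ y) := by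
  rw [Zf_zero, Zb_zero, symMσGAt_one_one_zero]
  have e1 : (fun κ x => piW (𝕜 := 𝕜) (GmL (Zf 𝕜 w v) (upF D) κ x)) = Yf w D := by
    funext κ x; exact piW_GmL_Zf w v D κ x
  have e2 : (fun κ x => piW (𝕜 := 𝕜) (GmbL (Zb 𝕜 w v) (upF D) κ x)) = Yb w D := by
    funext κ x; exact piW_GmbL_Zb w v D κ x
  have key : c11 (piW (𝕜 := 𝕜) (logT 𝕜 (symPhiMLAt 𝕜 ρ (Zf 𝕜 w v) (Zb 𝕜 w v) (upF D) L μ y)))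
      = c11 (logT 𝕜 (symPhiGAt 𝕜 ρ (Yf w D) (Yb w D) L μ y)) := by
    rw [map_logT, symPhiMLAt, map_symPhiGAt, e1, e2]
  rw [← c11_logT_symPhiGAt_Y ρ w D hd hL h2 μ y, ← key, piW_apply, Tau.c11_mk]

/-- [folklore] **THE `τ₂σ`-CONTACT JET IN COUNTS**: `c01 (…) = (2(d!)²L^d)⁻¹ • (symHessUAt ρ v D + (d ! : ℤ) • symLinU ρ [v, D])`. -/
theorem c01_symMσGAt_contact (ρ : Fin d → ℤ) (w v D : Form1 d 𝔸) {L : ℕ} (hd : ((d ! : ℕ) : 𝕜) ≠ 0) (hL : (L : 𝕜) ≠ 0) (h2 : (2 : 𝕜) ≠ 0) (μ : Fin d)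
    (y : Fin d → ℤ) :
    c01 (symMσGAt 𝕜 ρ (Zf 𝕜 w v) (Zb 𝕜 w v) (upF D) (Zf 𝕜 0 0) (Zb 𝕜 0 0) 0 L μ y)
      = ((2 : 𝕜) * ((d ! : 𝕜) ^ 2 * (L : 𝕜) ^ d))⁻¹ • (symHessUAt ρ v D L μ y + (d ! : ℤ) • symLinU ρ (bw v D) L μ y) := by
  rw [Zf_zero, Zb_zero, symMσGAt_one_one_zero]
  have e1 : (fun κ x => piV (𝕜 := 𝕜) (GmL (Zf 𝕜 w v) (upF D) κ x)) = Yf v D := by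
    funext κ x; exact piV_GmL_Zf w v D κ x
  have e2 : (fun κ x => piV (𝕜 := 𝕜) (GmbL (Zb 𝕜 w v) (upF D) κ x)) = Yb v D := by
    funext κ x; exact piV_GmbL_Zb w v D κ x
  have key : c11 (piV (𝕜 := 𝕜) (logT 𝕜 (symPhiMLAt 𝕜 ρ (Zf 𝕜 w v) (Zb 𝕜 w v) (upF D) L μ y)))
      = c11 (logT 𝕜 (symPhiGAt 𝕜 ρ (Yf v D) (Yb v D) L μ y)) := by
    rw [map_logT, symPhiMLAt, map_symPhiGAt, e1, e2]
  rw [← c11_logT_symPhiGAt_Y ρ v D hd hL h2 μ y, ← key, piV_apply, Tau.c11_mk]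

/-- [folklore] **THE `σ`-CONTACT JET IN COUNTS** (order `0` in the group directions): `c00 (…) = (d!·L^d)⁻¹ • symLinU ρ D`
(the augmented shadow is node 12's first-order chart `X1 D`; 33M3a `symPhiGAt_X1`). -/
theorem c00_symMσGAt_contact (ρ : Fin d → ℤ) (w v D : Form1 d 𝔸) {L : ℕ} (hd : ((d ! : ℕ) : 𝕜) ≠ 0) (hL : (L : 𝕜) ≠ 0) (μ : Fin d) (y : Fin d → ℤ) :
    c00 (symMσGAt 𝕜 ρ (Zf 𝕜 w v) (Zb 𝕜 w v) (upF D) (Zf 𝕜 0 0) (Zb 𝕜 0 0) 0 L μ y)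
      = ((d ! : 𝕜) * (L : 𝕜) ^ d)⁻¹ • symLinU ρ D L μ y := by
  rw [Zf_zero, Zb_zero, symMσGAt_one_one_zero]
  have e1 : (fun κ x => mapDual (aug (𝕜 := 𝕜)) (GmL (Zf 𝕜 w v) (upF D) κ x)) = X1 D := by
    funext κ x; exact aug_GmL_Zf w v D κ x
  have e2 : (fun κ x => mapDual (aug (𝕜 := 𝕜)) (GmbL (Zb 𝕜 w v) (upF D) κ x)) = X1b D := by
    funext κ x; exact aug_GmbL_Zb w v D κ x
  have key : (mapDual (aug (𝕜 := 𝕜)) (logT 𝕜 (symPhiMLAt 𝕜 ρ (Zf 𝕜 w v) (Zb 𝕜 w v) (upF D) L μ y))).snd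
      = (logT 𝕜 (symPhiGAt 𝕜 ρ (X1 D) (X1b D) L μ y)).snd := by
    rw [map_logT, symPhiMLAt, map_symPhiGAt, e1, e2]
  rw [snd_mapDual, aug_apply] at key
  rw [key, symPhiGAt_X1, logT_dmk_one, snd_dmk, inv_smul_sum_box_loopPAt ρ D hd hL μ y, add_sub_cancel]

/-! ## §3 The group part and the reference background in counts -/

/-- [folklore] THE GROUP PART: `c11 (logT Φ^M_ρ(W, V, B)).fst = (2(d!)²L^d)⁻¹ • symHessUAt ρ W V` (the group part of the mixed chart is the
symmetric chart `Φ^ρ(Zf W V, Zb W V)`; 33M3a `c11_logT_symPhiGAt_Zf`). -/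
theorem c11_fst_logT_symPhiMAt (ρ : Fin d → ℤ) (W V B : Form1 d 𝔸) {L : ℕ} (hd : ((d ! : ℕ) : 𝕜) ≠ 0) (hL : (L : 𝕜) ≠ 0) (h2 : (2 : 𝕜) ≠ 0) (μ : Fin d)
    (y : Fin d → ℤ) :
    c11 (logT 𝕜 (symPhiMAt 𝕜 ρ W V B L μ y)).fst = ((2 : 𝕜) * ((d ! : 𝕜) ^ 2 * (L : 𝕜) ^ d))⁻¹ • symHessUAt ρ W V L μ y := by
  rw [fst_logT, fst_symPhiMAt, c11_logT_symPhiGAt_Zf ρ W V hd hL h2 μ y]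

/-- [folklore] THE REFERENCE BACKGROUND: `Φ^M_ρ(0, 0, B).snd = ι ((d!·L^d)⁻¹ • symLinU ρ B)` (its letters are the scalar images `ι(X1 B)`,
`ι(X1b B)`; 33M3a `symPhiGAt_X1`). -/
theorem snd_symPhiMAt_zero_zero (ρ : Fin d → ℤ) (B : Form1 d 𝔸) {L : ℕ} (hd : ((d ! : ℕ) : 𝕜) ≠ 0) (hL : (L : 𝕜) ≠ 0) (μ : Fin d) (y : Fin d → ℤ) :
    (symPhiMAt 𝕜 ρ 0 0 B L μ y).snd = ι (((d ! : 𝕜) * (L : 𝕜) ^ d)⁻¹ • symLinU ρ B L μ y) := by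
  have e1 : (fun κ x => mapDual (ιHom (𝕜 := 𝕜)) (X1 B κ x)) = Gm 𝕜 0 0 B := by
    funext κ x
    exact TrivSqZeroExt.ext (ext4 (by simp [X1, Gm, Zf]) (by simp [X1, Gm, Zf]) (by simp [X1, Gm, Zf]) (by simp [X1, Gm, Zf]))
      (ext4 (by simp [X1, Gm, Zf]) (by simp [X1, Gm, Zf]) (by simp [X1, Gm, Zf]) (by simp [X1, Gm, Zf]))
  have e2 : (fun κ x => mapDual (ιHom (𝕜 := 𝕜)) (X1b B κ x)) = Gmb 𝕜 0 0 B := by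
    funext κ x
    exact TrivSqZeroExt.ext (ext4 (by simp [X1b, Gmb, Zb]) (by simp [X1b, Gmb, Zb]) (by simp [X1b, Gmb, Zb]) (by simp [X1b, Gmb, Zb]))
      (ext4 (by simp [X1b, Gmb, Zb]) (by simp [X1b, Gmb, Zb]) (by simp [X1b, Gmb, Zb]) (by simp [X1b, Gmb, Zb]))
  have key := map_symPhiGAt (R := DualNumber 𝔸) (R' := Rho 𝔸) (mapDual (ιHom (𝕜 := 𝕜))) ρ (X1 B) (X1b B) L μ y
  rw [e1, e2] at key
  rw [symPhiMAt, ← key, snd_mapDual, symPhiGAt_X1, snd_dmk, inv_smul_sum_box_loopPAt ρ B hd hL μ y, add_sub_cancel, ιHom_apply]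

/-! ## §4 The pull-back to the original side on the axis -/

section Longitudinal

variable {L : ℕ} (hL : Odd L) (h2 : (2 : 𝕜) ≠ 0)
include hL h2

/-- [folklore] `μ = α`: **THE MIXED AVERAGING AT THE PARTNER BOND IS THE INVERSE OF THE LEFT-CHART AVERAGING OF THE REFLECTED
LETTERS** — MX1's `symPhiMLAt_reflPair_self_eq_invT` solved for the original side (`invT_invT` in `Rho 𝔸`, `nil4_augR`). -/
theorem symPhiMAt_bref_self_eq_invT (α : Fin d) (W V B : Form1 d 𝔸) (y : Fin d → ℤ) :
    symPhiMAt 𝕜 (ctr d L) W V B L α (bref α α y)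
      = invT (symPhiMLAt 𝕜 (ctr d L) (Zf 𝕜 (R1g α W) (R1g α V)) (Zb 𝕜 (R1g α W) (R1g α V)) (BR (𝕜 := 𝕜) α W V B) L α y) := by
  have hΦ : augR 𝕜 (symPhiMAt 𝕜 (ctr d L) W V B L α (bref α α y)) = 1 :=
    aug_symPhiGAt_eq_one (augR_Gm W V B) (augR_Gmb W V B) (ctr d L) L α _
  rw [← reflPair_Zf_Zb, ← reflPair_Zb_Zf, symPhiMLAt_reflPair_self_eq_invT hL h2, invT_invT (nil4_augR (𝕜 := 𝕜)) hΦ]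

/-- [folklore] `μ = α`: the left-chart averaging of the reflected letters is `≡ 1 mod 𝔪`. -/
theorem augR_symPhiMLAt_refl (α : Fin d) (W V B : Form1 d 𝔸) (y : Fin d → ℤ) :
    augR 𝕜 (symPhiMLAt 𝕜 (ctr d L) (Zf 𝕜 (R1g α W) (R1g α V)) (Zb 𝕜 (R1g α W) (R1g α V)) (BR (𝕜 := 𝕜) α W V B) L α y) = 1 := by
  have hΦ : augR 𝕜 (symPhiMAt 𝕜 (ctr d L) W V B L α (bref α α y)) = 1 :=
    aug_symPhiGAt_eq_one (augR_Gm W V B) (augR_Gmb W V B) (ctr d L) L α _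
  rw [← reflPair_Zf_Zb, ← reflPair_Zb_Zf, symPhiMLAt_reflPair_self_eq_invT hL h2]
  exact aug_invT_eq_one hΦ

/-- [folklore] `μ = α`: **THE GROUP-PART LOGARITHM AT THE PARTNER BOND IS MINUS THE SYMMETRIC-CHART LOGARITHM OF THE REFLECTED
BACKGROUNDS** (`logT_invT` in `Rho 𝔸`, then `fst`). -/
theorem fst_logT_symPhiMAt_bref_self (α : Fin d) (W V B : Form1 d 𝔸) (y : Fin d → ℤ) :
    (logT 𝕜 (symPhiMAt 𝕜 (ctr d L) W V B L α (bref α α y))).fst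
      = -logT 𝕜 (symPhiGAt 𝕜 (ctr d L) (Zf 𝕜 (R1g α W) (R1g α V)) (Zb 𝕜 (R1g α W) (R1g α V)) L α y) := by
  rw [symPhiMAt_bref_self_eq_invT hL h2, logT_invT (nil4_augR (𝕜 := 𝕜)) h2 (augR_symPhiMLAt_refl hL h2 α W V B y),
    TrivSqZeroExt.fst_neg, fst_logT, fst_symPhiMLAt]

/-- [folklore] `μ = α`, IN COUNTS: `c11 (logT Φ^M_{(α, bref α α y)}(W, V, B)).fst = −(2(d!)²L^d)⁻¹ • symHessUAt ρ_c w v (α, y)`. -/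
theorem c11_fst_logT_symPhiMAt_bref_self (hd : ((d ! : ℕ) : 𝕜) ≠ 0) (hL0 : (L : 𝕜) ≠ 0) (α : Fin d) (W V B : Form1 d 𝔸) (y : Fin d → ℤ) :
    c11 (logT 𝕜 (symPhiMAt 𝕜 (ctr d L) W V B L α (bref α α y))).fst
      = -(((2 : 𝕜) * ((d ! : 𝕜) ^ 2 * (L : 𝕜) ^ d))⁻¹ • symHessUAt (ctr d L) (R1g α W) (R1g α V) L α y) := by
  rw [fst_logT_symPhiMAt_bref_self hL h2, c11_neg, c11_logT_symPhiGAt_Zf _ _ _ hd hL0 h2]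

/-- [folklore] `μ = α`, IN COUNTS: `Φ^M_{(α, bref α α y)}(0, 0, B).snd = −ι ((d!·L^d)⁻¹ • symLinU ρ_c b̃ (α, y))`. -/
theorem snd_symPhiMAt_zero_zero_bref_self (hd : ((d ! : ℕ) : 𝕜) ≠ 0) (hL0 : (L : 𝕜) ≠ 0) (α : Fin d) (B : Form1 d 𝔸) (y : Fin d → ℤ) :
    (symPhiMAt 𝕜 (ctr d L) 0 0 B L α (bref α α y)).snd = -ι (((d ! : 𝕜) * (L : 𝕜) ^ d)⁻¹ • symLinU (ctr d L) (R1g α B) L α y) := by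
  rw [symPhiMAt_bref_self_eq_invT hL h2, R1g_zero, BR_zero_zero, ← symPhiMAt_eq_symPhiMLAt,
    snd_invT_of_fst_eq_one (fst_symPhiMAt_zero_zero _ _ L α y), snd_symPhiMAt_zero_zero _ _ hd hL0]

/-- [folklore] `μ = α`: **THE COMMUTATOR OF 33M2's LONGITUDINAL LAW IN COUNTS**:
`c11 [ (logT Φ).fst, Φ₀.snd ] = [ (2(d!)²L^d)⁻¹ • symHessUAt ρ_c w v (α,y), (d!·L^d)⁻¹ • symLinU ρ_c b̃ (α,y) ]`. -/
theorem c11_comm_bref_self (hd : ((d ! : ℕ) : 𝕜) ≠ 0) (hL0 : (L : 𝕜) ≠ 0) (α : Fin d) (W V B : Form1 d 𝔸) (y : Fin d → ℤ) :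
    c11 ((logT 𝕜 (symPhiMAt 𝕜 (ctr d L) W V B L α (bref α α y))).fst * (symPhiMAt 𝕜 (ctr d L) 0 0 B L α (bref α α y)).snd
          - (symPhiMAt 𝕜 (ctr d L) 0 0 B L α (bref α α y)).snd * (logT 𝕜 (symPhiMAt 𝕜 (ctr d L) W V B L α (bref α α y))).fst)
      = AveragingHessianKernels.comm (((2 : 𝕜) * ((d ! : 𝕜) ^ 2 * (L : 𝕜) ^ d))⁻¹ • symHessUAt (ctr d L) (R1g α W) (R1g α V) L α y)
          (((d ! : 𝕜) * (L : 𝕜) ^ d)⁻¹ • symLinU (ctr d L) (R1g α B) L α y) := by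
  rw [snd_symPhiMAt_zero_zero_bref_self hL h2 hd hL0, mul_neg, neg_mul, sub_neg_eq_add, c11_add, c11_neg, c11_mul_ι, c11_ι_mul,
    c11_fst_logT_symPhiMAt_bref_self hL h2 hd hL0, AveragingHessianKernels.comm, neg_mul, mul_neg, neg_neg, sub_eq_add_neg]

end Longitudinal

/-! ## §5 The two axis-reflection laws of `symMjetAt` with all corrections in counts -/

section Laws

variable {L : ℕ} (hL : Odd L) (h2 : (2 : 𝕜) ≠ 0) (hd : ((d ! : ℕ) : 𝕜) ≠ 0) (hL0 : (L : 𝕜) ≠ 0)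
include hL h2 hd hL0

/-- [folklore] **`μ ≠ α`: THE TRANSVERSE REFLECTION LAW OF NODE 12b's ROOTED MIXED JET, ALL CORRECTIONS IN COUNTS**
(`w, v, b̃ = R1g α W, R1g α V, R1g α B`; `D1R`, `D2R`, `D12R` = 33M2's components of the axis correction):
`M(W,V;B)(μ, sref α y) = M(w,v;b̃)(μ,y) + (2(d!)²L^d)⁻¹ • (symHessUAt ρ_c v D1R + (d ! : ℤ) • symLinU ρ_c [v, D1R])`
`+ (2(d!)²L^d)⁻¹ • (symHessUAt ρ_c w D2R + (d ! : ℤ) • symLinU ρ_c [w, D2R]) + (d!·L^d)⁻¹ • symLinU ρ_c D12R` (all at `(μ, y)`). -/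
theorem symMjetAt_sref_of_ne_counts {α μ : Fin d} (h : μ ≠ α) (W V B : Form1 d 𝔸) (y : Fin d → ℤ) :
    symMjetAt 𝕜 (ctr d L) W V B L μ (sref α y)
      = symMjetAt 𝕜 (ctr d L) (R1g α W) (R1g α V) (R1g α B) L μ y
        + ((2 : 𝕜) * ((d ! : 𝕜) ^ 2 * (L : 𝕜) ^ d))⁻¹ • (symHessUAt (ctr d L) (R1g α V) (D1R α W V B) L μ y
            + (d ! : ℤ) • symLinU (ctr d L) (bw (R1g α V) (D1R α W V B)) L μ y)
        + ((2 : 𝕜) * ((d ! : 𝕜) ^ 2 * (L : 𝕜) ^ d))⁻¹ • (symHessUAt (ctr d L) (R1g α W) (D2R α W V B) L μ y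
            + (d ! : ℤ) • symLinU (ctr d L) (bw (R1g α W) (D2R α W V B)) L μ y)
        + ((d ! : 𝕜) * (L : 𝕜) ^ d)⁻¹ • symLinU (ctr d L) (D12R (𝕜 := 𝕜) α W V B) L μ y := by
  rw [symMjetAt_sref_of_ne hL h2 h, c11_symMσGAt_DR, c01_symMσGAt_contact _ _ _ _ hd hL0 h2, c10_symMσGAt_contact _ _ _ _ hd hL0 h2,
    c00_symMσGAt_contact _ _ _ _ hd hL0]
  simp only [add_assoc]

/-- [folklore] **`μ = α`: THE LONGITUDINAL REFLECTION LAW OF NODE 12b's ROOTED MIXED JET, ALL CORRECTIONS IN COUNTS**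
(`y′ = bref α α y`): `M(W,V;B)(α, y′) = −( M(w,v;b̃)(α,y) + [the three contact terms of the transverse law at μ = α]`
`+ [ (2(d!)²L^d)⁻¹ • symHessUAt ρ_c w v (α,y), (d!·L^d)⁻¹ • symLinU ρ_c b̃ (α,y) ] )`. -/
theorem symMjetAt_bref_self_counts (α : Fin d) (W V B : Form1 d 𝔸) (y : Fin d → ℤ) :
    symMjetAt 𝕜 (ctr d L) W V B L α (bref α α y)
      = -(symMjetAt 𝕜 (ctr d L) (R1g α W) (R1g α V) (R1g α B) L α y
          + ((2 : 𝕜) * ((d ! : 𝕜) ^ 2 * (L : 𝕜) ^ d))⁻¹ • (symHessUAt (ctr d L) (R1g α V) (D1R α W V B) L α y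
              + (d ! : ℤ) • symLinU (ctr d L) (bw (R1g α V) (D1R α W V B)) L α y)
          + ((2 : 𝕜) * ((d ! : 𝕜) ^ 2 * (L : 𝕜) ^ d))⁻¹ • (symHessUAt (ctr d L) (R1g α W) (D2R α W V B) L α y
              + (d ! : ℤ) • symLinU (ctr d L) (bw (R1g α W) (D2R α W V B)) L α y)
          + ((d ! : 𝕜) * (L : 𝕜) ^ d)⁻¹ • symLinU (ctr d L) (D12R (𝕜 := 𝕜) α W V B) L α y
          + AveragingHessianKernels.comm (((2 : 𝕜) * ((d ! : 𝕜) ^ 2 * (L : 𝕜) ^ d))⁻¹ • symHessUAt (ctr d L) (R1g α W) (R1g α V) L α y)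
              (((d ! : 𝕜) * (L : 𝕜) ^ d)⁻¹ • symLinU (ctr d L) (R1g α B) L α y)) := by
  rw [symMjetAt_bref_self hL h2, c11_symMσGAt_DR, c01_symMσGAt_contact _ _ _ _ hd hL0 h2, c10_symMσGAt_contact _ _ _ _ hd hL0 h2,
    c00_symMσGAt_contact _ _ _ _ hd hL0, c11_comm_bref_self hL h2 hd hL0]
  simp only [add_assoc]

end Laws

end Summit.QuantumFields.BalabanUV.Beta.SymRootedMixedJetContact
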